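import Literature.Geometry.Riemannian.BishopGromovVolumeComparison
import HarnessLib

/-!
# Almost antipodal points have uniformly small excess (`Ric ≥ n - 1`, `d(p, q) ≥ π - δ`)

In Colding's proof of the volume sphere theorem (`Colding1996_volume_ghClose`; Colding, Invent.
Math. 124 (1996) 175–191, §1, and Colding, *Aspects of Ricci curvature* (1997), §1–§2) the
function `cos d_p` is shown to be an almost solution of `Δf = -nf` by comparing it with
`-cos d_q` for an almost antipode `q` of `p`, `d(p, q) > π - δ` (such `q` exist at every `p` when
the volume is almost maximal — the tree's `exists_edist_ge_pi_sub_of_volume_ge`). The comparison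
rests on the classical consequence of the relative volume comparison proved here: on a closed
`n`-manifold with `Ric ≥ n - 1`, if `d(p, q) ≥ π - δ` then EVERY point `x` has small excess
  `e(x) = d(p, x) + d(x, q) - d(p, q) ≤ ψ(δ | n)`,
quantitatively `∫₀^{e(x)/2} sin^{n-1} ≤ δ` (`integral_sin_pow_excess_half_le`) and hence
`e(x)ⁿ ≤ 2 n π^{n-1} δ` for `δ < π/(2n)` (`excess_pow_le_of_edist_ge_pi_sub`,
`excess_pow_le_of_riemannianEDist_ge_pi_sub` in the binders of the fact) — so that
`|d(p, x) + d(x, q) - π| ≤ δ + ψ(δ | n)` uniformly in `x`, i.e. `cos d_q ≈ -cos d_p` uniformly.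
(For `δ = 0` this is the elementary half of Cheng's maximal diameter theorem: `d_p + d_q ≡ π`.)

Proof (Gromov's volume counting, as in the tree's `card_mul_le_unitSphereVolume_of_edist_gt`):
the closed balls `B̄_a(p)`, `B̄_b(q)`, `B̄_c(x)` with `a = d(p,x) - s`, `b = d(x,q) - s`,
`c < s`, `s > e/2` are pairwise disjoint, so by the relative Bishop–Gromov inequality
`Vol B̄_r/Vol M ≥ V₁(r)/|Sⁿ|` (`riemVolume_univ_mul_le_riemVolume_closedBall_mul`)
`I(a) + I(b) + I(c) ≤ I(π)`, `I(r) = ∫₀ʳ sin^{n-1}`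
(`integral_sin_pow_add_add_le_of_lt_edist`); on the other hand `a + b ≥ π - δ'` forces
`I(a) + I(b) ≥ I(π) - δ'` since `I(π) - I(a) = I(π - a)` and `sin^{n-1} ≤ 1`
(`integral_sin_pow_sub_le_add`); letting `s ↓ e/2`, `c ↑ e/2` gives `I(e/2) ≤ δ`, and Jordan's
inequality `sin t ≥ 2t/π` on `[0, π/2]` converts this into the power bound
(`pow_succ_le_of_integral_sin_pow_le`).

All results are proved; no definitions, no named facts (D-0026).

## References

* T. H. Colding, *Shape of manifolds with positive Ricci curvature*, Invent. Math. 124 (1996)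
  175–191, §1. [Colding1996Shape]
* T. H. Colding, *Aspects of Ricci curvature*, in: Comparison Geometry, MSRI Publ. 30 (1997)
  83–98, §1 (sketch of the proof of Thm. 1.1) and Thm. 2.2 with the remark following it (read:
  `lit read book:grove1997-comparison-geometry`, PDF pp. 110–114). [Colding1997Aspects]
* I. Chavel, *Riemannian Geometry: A Modern Introduction*, 2nd ed. (2006), Thm. III.4.5
  (Bishop–Gromov). [Chavel2006]
-/

noncomputable section

open Set Function Filter MeasureTheory Manifold intervalIntegral
open scoped Manifold ContDiff Topology ENNReal NNReal

namespace Literature.Geometry.Riemannian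

open Lorentzian Lorentzian.PseudoRiemannianMetric

/-! ### §1 One-variable lemmas on `I(r) = ∫₀ʳ sinᵈ` -/

section OneVariable

open Real

/-- `∫_a^b sinᵈ ≤ b - a` for `a ≤ b` (`|sinᵈ| ≤ 1`). [folklore] -/
theorem integral_sin_pow_le_sub (d : ℕ) {a b : ℝ} (hab : a ≤ b) :
    ∫ t in a..b, sin t ^ d ≤ b - a := by
  have h1 : ∫ t in a..b, sin t ^ d ≤ ∫ _ in a..b, (1:ℝ) :=
    integral_mono_on hab ((continuous_sin.pow d).intervalIntegrable a b) (by simp) fun t _ ↦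
      (le_abs_self _).trans (by rw [abs_pow]; exact pow_le_one₀ (abs_nonneg _) (abs_sin_le_one t))
  simpa using h1

/-- The symmetry `∫_a^π sinᵈ = ∫₀^{π-a} sinᵈ` (`sin (π - t) = sin t`). [folklore] -/
theorem integral_sin_pow_to_pi_eq (d : ℕ) (a : ℝ) :
    ∫ t in a..π, sin t ^ d = ∫ t in (0:ℝ)..(π - a), sin t ^ d := by
  have h := intervalIntegral.integral_comp_sub_left (fun t ↦ sin t ^ d) π (a := a) (b := π)
  simp only [sin_pi_sub, sub_self] at h
  exact h

/-- **Two radii adding up to almost `π` carry almost all of `I(π)`**: for `a, b ≤ π`,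
`δ ≥ 0` and `a + b ≥ π - δ`, `I(π) - δ ≤ I(a) + I(b)` where `I(r) = ∫₀ʳ sinᵈ`
(`I(π) - I(a) = I(π - a)` and `I(π - a) - I(b) ≤ (π - a) - b ≤ δ` when `b < π - a`).
[folklore] -/
theorem integral_sin_pow_sub_le_add (d : ℕ) {a b δ : ℝ} (haπ : a ≤ π) (hbπ : b ≤ π)
    (hδ : 0 ≤ δ) (hab : π - δ ≤ a + b) :
    (∫ t in (0:ℝ)..π, sin t ^ d) - δ ≤
      (∫ t in (0:ℝ)..a, sin t ^ d) + ∫ t in (0:ℝ)..b, sin t ^ d := by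
  have hint : ∀ u v : ℝ, IntervalIntegrable (fun t ↦ sin t ^ d) volume u v := fun u v ↦
    (continuous_sin.pow d).intervalIntegrable u v
  have hnn : ∀ u v : ℝ, 0 ≤ u → u ≤ v → v ≤ π → 0 ≤ ∫ t in u..v, sin t ^ d :=
    fun u v hu huv hv ↦ integral_nonneg huv fun t ht ↦
      pow_nonneg (sin_nonneg_of_nonneg_of_le_pi (hu.trans ht.1) (ht.2.trans hv)) d
  -- `∫₀^π = ∫₀^a + ∫₀^{π-a}`
  have hsplit : ∫ t in (0:ℝ)..π, sin t ^ d =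
      (∫ t in (0:ℝ)..a, sin t ^ d) + ∫ t in (0:ℝ)..(π - a), sin t ^ d := by
    rw [← integral_sin_pow_to_pi_eq d a, integral_add_adjacent_intervals (hint 0 a) (hint a π)]
  rw [hsplit]
  rcases le_or_gt (π - a) b with hle | hlt
  · -- `b ≥ π - a`
    have h1 : ∫ t in (0:ℝ)..(π - a), sin t ^ d ≤ ∫ t in (0:ℝ)..b, sin t ^ d := by
      rw [← integral_add_adjacent_intervals (hint 0 (π - a)) (hint (π - a) b)]
      linarith [hnn (π - a) b (by linarith) hle hbπ]
    linarith
  · -- `b < π - a`: `∫_b^{π-a} sinᵈ ≤ (π - a) - b ≤ δ`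
    have h1 : ∫ t in (0:ℝ)..(π - a), sin t ^ d =
        (∫ t in (0:ℝ)..b, sin t ^ d) + ∫ t in b..(π - a), sin t ^ d :=
      (integral_add_adjacent_intervals (hint 0 b) (hint b (π - a))).symm
    have h2 : ∫ t in b..(π - a), sin t ^ d ≤ (π - a) - b := integral_sin_pow_le_sub d hlt.le
    rw [h1]
    linarith

/-- **Jordan's inequality integrated**: for `0 ≤ r ≤ π/2`,
`(2/π)ᵈ r^{d+1}/(d+1) ≤ ∫₀ʳ sinᵈ` (`sin t ≥ 2t/π` on `[0, π/2]`, `Real.mul_le_sin`). [folklore] -/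
theorem jordan_pow_le_integral_sin_pow (d : ℕ) {r : ℝ} (hr0 : 0 ≤ r) (hr : r ≤ π / 2) :
    (2 / π) ^ d * r ^ (d + 1) / (d + 1) ≤ ∫ t in (0:ℝ)..r, sin t ^ d := by
  have hint : IntervalIntegrable (fun t ↦ sin t ^ d) volume 0 r :=
    (continuous_sin.pow d).intervalIntegrable 0 r
  have hint' : IntervalIntegrable (fun t : ℝ ↦ (2 / π * t) ^ d) volume 0 r :=
    ((continuous_const.mul continuous_id).pow d).intervalIntegrable 0 r
  have h1 : ∫ t in (0:ℝ)..r, (2 / π * t) ^ d ≤ ∫ t in (0:ℝ)..r, sin t ^ d :=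
    integral_mono_on hr0 hint' hint fun t ht ↦
      pow_le_pow_left₀ (mul_nonneg (div_nonneg zero_le_two pi_pos.le) ht.1)
        (mul_le_sin ht.1 (ht.2.trans hr)) d
  have h2 : ∫ t in (0:ℝ)..r, (2 / π * t) ^ d = (2 / π) ^ d * r ^ (d + 1) / (d + 1) := by
    simp_rw [mul_pow]
    rw [intervalIntegral.integral_const_mul, integral_pow, zero_pow (Nat.succ_ne_zero d), sub_zero]
    ring
  rw [← h2]
  exact h1

/-- **Small `I(r)` forces small `r`**: if `0 ≤ r ≤ π`, `δ < π/(2(d+1))` and `∫₀ʳ sinᵈ ≤ δ`, then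
`r^{d+1} ≤ (d+1) (π/2)ᵈ δ`. (First `r ≤ π/2`, since `∫₀^{π/2} sinᵈ ≥ π/(2(d+1)) > δ` by Jordan;
then Jordan on `[0, r]`.) [folklore] -/
theorem pow_succ_le_of_integral_sin_pow_le (d : ℕ) {r δ : ℝ} (hr0 : 0 ≤ r) (hrπ : r ≤ π)
    (hδ : δ < π / (2 * (d + 1))) (h : ∫ t in (0:ℝ)..r, sin t ^ d ≤ δ) :
    r ^ (d + 1) ≤ (d + 1) * (π / 2) ^ d * δ := by
  have hint : ∀ u v : ℝ, IntervalIntegrable (fun t ↦ sin t ^ d) volume u v := fun u v ↦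
    (continuous_sin.pow d).intervalIntegrable u v
  have hd1 : (0 : ℝ) < d + 1 := by positivity
  have hππ : (2 / π) ^ d * (π / 2) ^ d = 1 := by
    rw [← mul_pow, div_mul_div_comm, mul_comm 2 π, div_self (by positivity), one_pow]
  -- Jordan at `π/2`: `∫₀^{π/2} sinᵈ ≥ π/(2(d+1))`
  have hhalf : π / (2 * (d + 1)) ≤ ∫ t in (0:ℝ)..(π / 2), sin t ^ d := by
    have h1 := jordan_pow_le_integral_sin_pow d (by positivity : (0:ℝ) ≤ π / 2) le_rfl
    have h2 : (2 / π) ^ d * (π / 2) ^ (d + 1) / (d + 1) = π / (2 * (d + 1)) := by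
      rw [pow_succ, ← mul_assoc, hππ, one_mul, div_div]
    rwa [h2] at h1
  -- hence `r ≤ π/2`
  have hr2 : r ≤ π / 2 := by
    by_contra hlt
    push Not at hlt
    have h1 : ∫ t in (0:ℝ)..(π / 2), sin t ^ d ≤ ∫ t in (0:ℝ)..r, sin t ^ d := by
      rw [← integral_add_adjacent_intervals (hint 0 (π / 2)) (hint (π / 2) r)]
      have : 0 ≤ ∫ t in (π / 2)..r, sin t ^ d :=
        integral_nonneg hlt.le fun t ht ↦ pow_nonneg
          (sin_nonneg_of_nonneg_of_le_pi (by linarith [ht.1, pi_pos]) (ht.2.trans hrπ)) d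
      linarith
    linarith
  -- Jordan on `[0, r]`
  have h3 := (jordan_pow_le_integral_sin_pow d hr0 hr2).trans h
  rw [div_le_iff₀ hd1] at h3
  calc r ^ (d + 1) = (π / 2) ^ d * ((2 / π) ^ d * r ^ (d + 1)) := by
        rw [← mul_assoc, mul_comm ((π / 2) ^ d), hππ, one_mul]
    _ ≤ (π / 2) ^ d * (δ * (d + 1)) := mul_le_mul_of_nonneg_left h3 (by positivity)
    _ = (d + 1) * (π / 2) ^ d * δ := by ring

/-- `r ↦ ∫₀ʳ sinᵈ` is continuous. [folklore] -/
theorem continuous_integral_sin_pow (d : ℕ) : Continuous fun r : ℝ ↦ ∫ t in (0:ℝ)..r, sin t ^ d :=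
  intervalIntegral.continuous_primitive
    (fun u v ↦ (continuous_sin.pow d).intervalIntegrable u v) 0

end OneVariable

/-! ### §2 Three disjoint balls and the excess estimate -/

section Excess

variable {m : ℕ} {M : Type*} [TopologicalSpace M] [T2Space M] [SecondCountableTopology M]
  [ChartedSpace (EuclideanSpace ℝ (Fin m)) M] [IsManifold (𝓡 m) ∞ M] [T3Space M]
  [MeasurableSpace M] [BorelSpace M]
  (g : PseudoRiemannianMetric (𝓡 m) ∞ (EuclideanSpace ℝ (Fin m)) (TangentSpace (𝓡 m) : M → Type _))
  [ConnectedSpace M] [CompactSpace M] [g.HasLeviCivita]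

/-- **Volume counting with three disjoint balls** (Gromov; the mechanism of
`card_mul_le_unitSphereVolume_of_edist_gt`). On a compact connected Riemannian `m`-manifold,
`m ≥ 2`, `Ric ≥ (m - 1) g`: if `a, b, c ∈ [0, π]` and `d(p, q) > a + b`, `d(p, x) > a + c`,
`d(x, q) > b + c`, then the closed balls `B̄_a(p)`, `B̄_b(q)`, `B̄_c(x)` are pairwise disjoint,
each satisfies `Vol(M) · |S^{m-1}| ∫₀ʳ sin^{m-1} ≤ Vol B̄_r · |Sᵐ|`
(`riemVolume_univ_mul_le_riemVolume_closedBall_mul`), and summing,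
`∫₀ᵃ sin^{m-1} + ∫₀ᵇ sin^{m-1} + ∫₀ᶜ sin^{m-1} ≤ ∫₀^π sin^{m-1}` (`= |Sᵐ|/|S^{m-1}|`).
[cite: Chavel2006, Thm. III.4.5] [cite: Colding1997Aspects, §2 (proof of Thm. 2.2)] -/
theorem integral_sin_pow_add_add_le_of_lt_edist (hg : g.IsRiemannian) (hm : 2 ≤ m)
    (hRic : ∀ (x : M) (w : TangentSpace (𝓡 m) x), ((m : ℝ) - 1) * g.val x w w ≤ g.ricci x w w)
    {p q x : M} {a b c : ℝ} (ha0 : 0 ≤ a) (hb0 : 0 ≤ b) (hc0 : 0 ≤ c) (haπ : a ≤ Real.pi)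
    (hbπ : b ≤ Real.pi) (hcπ : c ≤ Real.pi)
    (hpq : ENNReal.ofReal (a + b) < g.edist hg p q) (hpx : ENNReal.ofReal (a + c) < g.edist hg p x)
    (hxq : ENNReal.ofReal (b + c) < g.edist hg x q) :
    (∫ t in (0:ℝ)..a, Real.sin t ^ (m - 1)) + (∫ t in (0:ℝ)..b, Real.sin t ^ (m - 1)) +
        ∫ t in (0:ℝ)..c, Real.sin t ^ (m - 1) ≤
      ∫ t in (0:ℝ)..Real.pi, Real.sin t ^ (m - 1) := by
  obtain ⟨k, rfl⟩ : ∃ k, m = k + 1 := ⟨m - 1, by omega⟩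
  simp only [Nat.add_sub_cancel]
  set I : ℝ → ℝ := fun r ↦ ∫ t in (0:ℝ)..r, Real.sin t ^ k with hI_def
  have hI0 : ∀ r, 0 ≤ r → r ≤ Real.pi → 0 ≤ I r := fun r hr hrπ ↦
    intervalIntegral.integral_nonneg hr fun t ht ↦
      pow_nonneg (Real.sin_nonneg_of_nonneg_of_le_pi ht.1 (ht.2.trans hrπ)) k
  -- `0 < Vol(M) < ∞`
  have hfin : g.riemVolume (univ : Set M) ≠ ⊤ :=
    ((riemVolume_univ_le_unitSphereVolume g hg hm hRic).trans_lt ENNReal.ofReal_lt_top).ne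
  have hpos : g.riemVolume (univ : Set M) ≠ 0 := by
    haveI : g.riemVolume.IsOpenPosMeasure := by
      rw [PseudoRiemannianMetric.riemVolume_eq hg]
      exact isOpenPosMeasure_riemannianMeasure _
    exact isOpen_univ.measure_ne_zero g.riemVolume ⟨p, mem_univ _⟩
  -- the balls
  set B : M → ℝ → Set M := fun z r ↦ {y : M | g.edist hg z y ≤ ENNReal.ofReal r} with hB_def
  have hmeasB : ∀ z r, MeasurableSet (B z r) := fun z r ↦
    (isClosed_le ((PseudoRiemannianMetric.continuous_edist hg).comp
      (continuous_const.prodMk continuous_id)) continuous_const).measurableSet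
  -- disjointness from the triangle inequality
  have hdisj : ∀ (z w : M) (r s : ℝ), 0 ≤ r → 0 ≤ s →
      ENNReal.ofReal (r + s) < g.edist hg z w → Disjoint (B z r) (B w s) := by
    intro z w r s hr hs hzw
    rw [Set.disjoint_left]
    intro y hyz hyw
    have hyz' : g.edist hg z y ≤ ENNReal.ofReal r := hyz
    have hyw' : g.edist hg y w ≤ ENNReal.ofReal s := by
      rw [PseudoRiemannianMetric.edist_comm hg]; exact hyw
    have hle : g.edist hg z w ≤ ENNReal.ofReal (r + s) :=
      calc g.edist hg z w ≤ g.edist hg z y + g.edist hg y w :=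
            PseudoRiemannianMetric.edist_triangle hg z y w
        _ ≤ ENNReal.ofReal r + ENNReal.ofReal s := add_le_add hyz' hyw'
        _ = ENNReal.ofReal (r + s) := (ENNReal.ofReal_add hr hs).symm
    exact (not_lt.2 hle) hzw
  have hd1 : Disjoint (B p a) (B q b) := hdisj p q a b ha0 hb0 hpq
  have hd2 : Disjoint (B p a) (B x c) := hdisj p x a c ha0 hc0 hpx
  have hd3 : Disjoint (B q b) (B x c) := by
    refine hdisj q x b c hb0 hc0 ?_
    rw [PseudoRiemannianMetric.edist_comm hg]; exact hxq
  -- per ball: `Vol(M) |S^{k}| I(r) ≤ Vol(B̄_r) |S^{k+1}|`, also for `r = 0`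
  have hball : ∀ (z : M) (r : ℝ), 0 ≤ r → r ≤ Real.pi →
      g.riemVolume (univ : Set M) * ENNReal.ofReal (unitSphereVolume k * I r) ≤
        g.riemVolume (B z r) * ENNReal.ofReal (unitSphereVolume (k + 1)) := by
    intro z r hr hrπ
    rcases hr.eq_or_lt with rfl | hr'
    · simp [hI_def]
    · have h := riemVolume_univ_mul_le_riemVolume_closedBall_mul g hg hm hRic z hr' hrπ
      rw [Nat.add_sub_cancel] at h
      exact h
  -- summing
  have hsum : g.riemVolume (univ : Set M) *
      (ENNReal.ofReal (unitSphereVolume k * I a) + ENNReal.ofReal (unitSphereVolume k * I b) +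
        ENNReal.ofReal (unitSphereVolume k * I c)) ≤
      g.riemVolume (univ : Set M) * ENNReal.ofReal (unitSphereVolume (k + 1)) :=
    calc g.riemVolume (univ : Set M) *
          (ENNReal.ofReal (unitSphereVolume k * I a) + ENNReal.ofReal (unitSphereVolume k * I b) +
            ENNReal.ofReal (unitSphereVolume k * I c))
        = g.riemVolume (univ : Set M) * ENNReal.ofReal (unitSphereVolume k * I a) +
            g.riemVolume (univ : Set M) * ENNReal.ofReal (unitSphereVolume k * I b) +
            g.riemVolume (univ : Set M) * ENNReal.ofReal (unitSphereVolume k * I c) := by ring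
      _ ≤ g.riemVolume (B p a) * ENNReal.ofReal (unitSphereVolume (k + 1)) +
            g.riemVolume (B q b) * ENNReal.ofReal (unitSphereVolume (k + 1)) +
            g.riemVolume (B x c) * ENNReal.ofReal (unitSphereVolume (k + 1)) :=
          add_le_add (add_le_add (hball p a ha0 haπ) (hball q b hb0 hbπ)) (hball x c hc0 hcπ)
      _ = g.riemVolume (B p a ∪ B q b ∪ B x c) * ENNReal.ofReal (unitSphereVolume (k + 1)) := by
          rw [measure_union (disjoint_union_left.2 ⟨hd2, hd3⟩) (hmeasB x c),
            measure_union hd1 (hmeasB q b)]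
          ring
      _ ≤ g.riemVolume (univ : Set M) * ENNReal.ofReal (unitSphereVolume (k + 1)) :=
          mul_le_mul_left (measure_mono (subset_univ _)) _
  have hcancel := (ENNReal.mul_le_mul_iff_right hpos hfin).1 hsum
  -- back to real numbers
  have hωk : 0 < unitSphereVolume k := unitSphereVolume_pos k
  have hIa := hI0 a ha0 haπ
  have hIb := hI0 b hb0 hbπ
  have hIc := hI0 c hc0 hcπ
  rw [← ENNReal.ofReal_add (mul_nonneg hωk.le hIa) (mul_nonneg hωk.le hIb),
    ← ENNReal.ofReal_add (add_nonneg (mul_nonneg hωk.le hIa) (mul_nonneg hωk.le hIb))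
      (mul_nonneg hωk.le hIc),
    unitSphereVolume_succ_eq_mul_integral_sin_pow k,
    ENNReal.ofReal_le_ofReal_iff (mul_nonneg hωk.le (hI0 Real.pi Real.pi_pos.le le_rfl))] at hcancel
  have h' : unitSphereVolume k * (I a + I b + I c) ≤
      unitSphereVolume k * ∫ t in (0:ℝ)..Real.pi, Real.sin t ^ k := by
    have : unitSphereVolume k * (I a + I b + I c) =
        unitSphereVolume k * I a + unitSphereVolume k * I b + unitSphereVolume k * I c := by ring
    rw [this]
    exact hcancel
  exact le_of_mul_le_mul_left h' hωk

/-- **Almost antipodal points have small excess, integral form** (Colding 1996, §1; Colding 1997,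
§1–§2: `d(p, q) > π - δ` ⇒ `d_p + d_q ≈ π` uniformly). On a compact connected Riemannian
`m`-manifold, `m ≥ 2`, with `Ric ≥ (m - 1) g`, let `δ ≥ 0` and `d(p, q) ≥ π - δ`. Then for every
`x`, the excess `e(x) = d(p, x) + d(x, q) - d(p, q)` satisfies
  `∫₀^{e(x)/2} sin^{m-1} t dt ≤ δ`.
Proof: three disjoint balls `B̄_{d(p,x)-s}(p)`, `B̄_{d(x,q)-s}(q)`, `B̄_{e/2-η}(x)`, `s = e/2 + η`
(`integral_sin_pow_add_add_le_of_lt_edist`), the two big radii adding up to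
`d(p, q) - 2η ≥ π - δ - 2η` (`integral_sin_pow_sub_le_add`), and `η → 0`.
[cite: Colding1996Shape, §1] [cite: Colding1997Aspects, §1–§2] -/
theorem integral_sin_pow_excess_half_le (hg : g.IsRiemannian) (hm : 2 ≤ m)
    (hRic : ∀ (x : M) (w : TangentSpace (𝓡 m) x), ((m : ℝ) - 1) * g.val x w w ≤ g.ricci x w w)
    {p q : M} {δ : ℝ} (hδ : 0 ≤ δ) (hpq : ENNReal.ofReal (Real.pi - δ) ≤ g.edist hg p q)
    (x : M) :
    ∫ t in (0:ℝ)..(((g.edist hg p x).toReal + (g.edist hg x q).toReal -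
        (g.edist hg p q).toReal) / 2), Real.sin t ^ (m - 1) ≤ δ := by
  obtain ⟨k, rfl⟩ : ∃ k, m = k + 1 := ⟨m - 1, by omega⟩
  simp only [Nat.add_sub_cancel]
  have hfinE : Module.finrank ℝ (EuclideanSpace ℝ (Fin (k + 1))) = k + 1 :=
    finrank_euclideanSpace_fin
  set I : ℝ → ℝ := fun r ↦ ∫ t in (0:ℝ)..r, Real.sin t ^ k with hI_def
  -- the three distances as real numbers
  have hne : ∀ y z : M, g.edist hg y z ≠ ⊤ := fun y z ↦ edist_ne_top hg y z
  set dpx : ℝ := (g.edist hg p x).toReal with hdpx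
  set dxq : ℝ := (g.edist hg x q).toReal with hdxq
  set dpq : ℝ := (g.edist hg p q).toReal with hdpq
  have h0px : 0 ≤ dpx := ENNReal.toReal_nonneg
  have h0xq : 0 ≤ dxq := ENNReal.toReal_nonneg
  have h0pq : 0 ≤ dpq := ENNReal.toReal_nonneg
  -- Myers: all distances are `≤ π`
  have hle_pi : ∀ y z : M, (g.edist hg y z).toReal ≤ Real.pi := by
    intro y z
    have h := edist_le_pi_div_sqrt_of_ricci_ge_of_compactSpace g hg (by rw [hfinE]; exact hm)
      one_pos (fun y w ↦ by rw [hfinE, mul_one]; exact hRic y w) y z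
    rw [Real.sqrt_one, div_one] at h
    exact ENNReal.toReal_le_of_le_ofReal Real.pi_pos.le h
  have hpxπ : dpx ≤ Real.pi := hle_pi p x
  have hxqπ : dxq ≤ Real.pi := hle_pi x q
  -- triangle inequalities
  have htri : ∀ y z w : M, (g.edist hg y w).toReal ≤ (g.edist hg y z).toReal + (g.edist hg z w).toReal := by
    intro y z w
    rw [← ENNReal.toReal_add (hne y z) (hne z w)]
    exact ENNReal.toReal_mono (ENNReal.add_ne_top.2 ⟨hne y z, hne z w⟩)
      (PseudoRiemannianMetric.edist_triangle hg y z w)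
  have ht1 : dpq ≤ dpx + dxq := htri p x q
  have ht2 : dpx ≤ dpq + dxq := by
    have h := htri p q x
    rw [PseudoRiemannianMetric.edist_comm hg q x] at h
    exact h
  have ht3 : dxq ≤ dpx + dpq := by
    have h := htri x p q
    rw [PseudoRiemannianMetric.edist_comm hg x p] at h
    exact h
  -- `d(p, q) ≥ π - δ`
  have hpq' : Real.pi - δ ≤ dpq := (ENNReal.ofReal_le_iff_le_toReal (hne p q)).1 hpq
  -- the excess
  set e : ℝ := dpx + dxq - dpq with he_def
  have he0 : 0 ≤ e := by rw [he_def]; linarith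
  change I (e / 2) ≤ δ
  have hI0 : ∀ r, 0 ≤ r → r ≤ Real.pi → 0 ≤ I r := fun r hr hrπ ↦
    intervalIntegral.integral_nonneg hr fun t ht ↦
      pow_nonneg (Real.sin_nonneg_of_nonneg_of_le_pi ht.1 (ht.2.trans hrπ)) k
  -- degenerate case `d(p, q) = 0`: then `δ ≥ π ≥ e/2 ≥ I(e/2)`
  rcases h0pq.eq_or_lt with hpq0 | hpq_pos
  · have h1 : I (e / 2) ≤ e / 2 := by
      have h := integral_sin_pow_le_sub k (by linarith : (0:ℝ) ≤ e / 2)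
      rw [sub_zero] at h
      exact h
    have h2 : e / 2 ≤ Real.pi := by rw [he_def]; linarith
    linarith
  -- main case: the three balls, for small `η > 0`
  have key : ∀ η : ℝ, 0 < η → η ≤ e / 2 → 2 * η < dpq → I (e / 2 - η) ≤ δ + 2 * η := by
    intro η hη hηe hηpq
    set s : ℝ := e / 2 + η with hs_def
    set a : ℝ := max (dpx - s) 0 with ha_def
    set b : ℝ := max (dxq - s) 0 with hb_def
    set c : ℝ := e / 2 - η with hc_def
    have ha0 : 0 ≤ a := le_max_right _ _
    have hb0 : 0 ≤ b := le_max_right _ _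
    have hc0 : 0 ≤ c := by rw [hc_def]; linarith
    have haπ : a ≤ Real.pi := max_le (by linarith) Real.pi_pos.le
    have hbπ : b ≤ Real.pi := max_le (by linarith) Real.pi_pos.le
    have hcπ : c ≤ Real.pi := by rw [hc_def, he_def]; linarith
    -- the strict separations
    have hac : a + c < dpx := by
      rcases le_total (dpx - s) 0 with h | h
      · rw [ha_def, max_eq_right h]; rw [hc_def, he_def]; linarith
      · rw [ha_def, max_eq_left h]; rw [hs_def, hc_def]; linarith
    have hbc : b + c < dxq := by
      rcases le_total (dxq - s) 0 with h | h
      · rw [hb_def, max_eq_right h]; rw [hc_def, he_def]; linarith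
      · rw [hb_def, max_eq_left h]; rw [hs_def, hc_def]; linarith
    have hab : a + b < dpq := by
      rcases le_total (dpx - s) 0 with h1 | h1 <;> rcases le_total (dxq - s) 0 with h2 | h2
      · rw [ha_def, hb_def, max_eq_right h1, max_eq_right h2]; linarith
      · rw [ha_def, hb_def, max_eq_right h1, max_eq_left h2]; rw [hs_def, he_def]; linarith
      · rw [ha_def, hb_def, max_eq_left h1, max_eq_right h2]; rw [hs_def, he_def]; linarith
      · rw [ha_def, hb_def, max_eq_left h1, max_eq_left h2]; rw [hs_def, he_def]; linarith
    have hab' : Real.pi - (δ + 2 * η) ≤ a + b := by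
      have h1 : dpx - s ≤ a := le_max_left _ _
      have h2 : dxq - s ≤ b := le_max_left _ _
      rw [hs_def, he_def] at h1 h2
      linarith
    -- in `ℝ≥0∞`
    have hpq_e : ENNReal.ofReal (a + b) < g.edist hg p q :=
      (ENNReal.ofReal_lt_iff_lt_toReal (add_nonneg ha0 hb0) (hne p q)).2 hab
    have hpx_e : ENNReal.ofReal (a + c) < g.edist hg p x :=
      (ENNReal.ofReal_lt_iff_lt_toReal (add_nonneg ha0 hc0) (hne p x)).2 hac
    have hxq_e : ENNReal.ofReal (b + c) < g.edist hg x q :=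
      (ENNReal.ofReal_lt_iff_lt_toReal (add_nonneg hb0 hc0) (hne x q)).2 hbc
    have h3 := integral_sin_pow_add_add_le_of_lt_edist g hg hm hRic ha0 hb0 hc0 haπ hbπ hcπ
      hpq_e hpx_e hxq_e
    simp only [Nat.add_sub_cancel] at h3
    have h4 := integral_sin_pow_sub_le_add k haπ hbπ (by linarith) hab'
    change I a + I b + I c ≤ I Real.pi at h3
    change I Real.pi - (δ + 2 * η) ≤ I a + I b at h4
    linarith
  -- let `η → 0⁺`
  rcases he0.eq_or_lt with he00 | he_pos
  · -- `e = 0`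
    rw [← he00, zero_div, hI_def]
    simp only [intervalIntegral.integral_same]
    exact hδ
  have hIc : Continuous I := continuous_integral_sin_pow k
  have hlim1 : Tendsto (fun η : ℝ ↦ I (e / 2 - η)) (𝓝[>] 0) (𝓝 (I (e / 2))) := by
    have h1 : Tendsto (fun η : ℝ ↦ e / 2 - η) (𝓝 0) (𝓝 (e / 2 - 0)) :=
      tendsto_const_nhds.sub tendsto_id
    rw [sub_zero] at h1
    exact ((hIc.tendsto _).comp h1).mono_left nhdsWithin_le_nhds
  have hlim2 : Tendsto (fun η : ℝ ↦ δ + 2 * η) (𝓝[>] 0) (𝓝 δ) := by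
    have h1 : Tendsto (fun η : ℝ ↦ δ + 2 * η) (𝓝 0) (𝓝 (δ + 2 * 0)) :=
      tendsto_const_nhds.add (tendsto_const_nhds.mul tendsto_id)
    rw [mul_zero, add_zero] at h1
    exact h1.mono_left nhdsWithin_le_nhds
  refine le_of_tendsto_of_tendsto hlim1 hlim2 ?_
  have hη0 : 0 < min (e / 2) (dpq / 2) := lt_min (by linarith) (by linarith)
  filter_upwards [Ioo_mem_nhdsGT hη0] with η hη
  exact key η hη.1 (hη.2.le.trans (min_le_left _ _))
    (by linarith [hη.2, min_le_right (e / 2) (dpq / 2)])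

/-- **Almost antipodal points have small excess** (Colding 1996, §1; Colding 1997, §1–§2), power
form: on a compact connected Riemannian `m`-manifold, `m ≥ 2`, with `Ric ≥ (m - 1) g`, if
`0 ≤ δ < π/(2m)` and `d(p, q) ≥ π - δ`, then every `x` satisfies
  `(d(p, x) + d(x, q) - d(p, q))ᵐ ≤ 2 m π^{m-1} δ`,
i.e. `e(x) ≤ (2mπ^{m-1})^{1/m} δ^{1/m} = ψ(δ | m)` (`integral_sin_pow_excess_half_le` and Jordan's
inequality, `pow_succ_le_of_integral_sin_pow_le`). Consequently
`|d(p, x) + d(x, q) - π| ≤ δ + ψ(δ | m)` uniformly in `x`.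
[cite: Colding1996Shape, §1] [cite: Colding1997Aspects, §1–§2] -/
theorem excess_pow_le_of_edist_ge_pi_sub (hg : g.IsRiemannian) (hm : 2 ≤ m)
    (hRic : ∀ (x : M) (w : TangentSpace (𝓡 m) x), ((m : ℝ) - 1) * g.val x w w ≤ g.ricci x w w)
    {p q : M} {δ : ℝ} (hδ : 0 ≤ δ) (hδm : δ < Real.pi / (2 * m))
    (hpq : ENNReal.ofReal (Real.pi - δ) ≤ g.edist hg p q) (x : M) :
    ((g.edist hg p x).toReal + (g.edist hg x q).toReal - (g.edist hg p q).toReal) ^ m ≤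
      2 * m * Real.pi ^ (m - 1) * δ := by
  have h := integral_sin_pow_excess_half_le g hg hm hRic hδ hpq x
  obtain ⟨k, rfl⟩ : ∃ k, m = k + 1 := ⟨m - 1, by omega⟩
  simp only [Nat.add_sub_cancel] at h ⊢
  have hfinE : Module.finrank ℝ (EuclideanSpace ℝ (Fin (k + 1))) = k + 1 :=
    finrank_euclideanSpace_fin
  have hne : ∀ y z : M, g.edist hg y z ≠ ⊤ := fun y z ↦ edist_ne_top hg y z
  set dpx : ℝ := (g.edist hg p x).toReal with hdpx
  set dxq : ℝ := (g.edist hg x q).toReal with hdxq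
  set dpq : ℝ := (g.edist hg p q).toReal with hdpq
  have hle_pi : ∀ y z : M, (g.edist hg y z).toReal ≤ Real.pi := by
    intro y z
    have h := edist_le_pi_div_sqrt_of_ricci_ge_of_compactSpace g hg (by rw [hfinE]; exact hm)
      one_pos (fun y w ↦ by rw [hfinE, mul_one]; exact hRic y w) y z
    rw [Real.sqrt_one, div_one] at h
    exact ENNReal.toReal_le_of_le_ofReal Real.pi_pos.le h
  have ht1 : dpq ≤ dpx + dxq := by
    rw [hdpq, hdpx, hdxq, ← ENNReal.toReal_add (hne p x) (hne x q)]
    exact ENNReal.toReal_mono (ENNReal.add_ne_top.2 ⟨hne p x, hne x q⟩)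
      (PseudoRiemannianMetric.edist_triangle hg p x q)
  set e : ℝ := dpx + dxq - dpq with he_def
  have he0 : 0 ≤ e := by rw [he_def]; linarith
  have heπ : e / 2 ≤ Real.pi := by
    have h1 : dpx ≤ Real.pi := hle_pi p x
    have h2 : dxq ≤ Real.pi := hle_pi x q
    have h3 : 0 ≤ dpq := ENNReal.toReal_nonneg
    rw [he_def]; linarith
  have hδk : δ < Real.pi / (2 * (k + 1)) := by push_cast at hδm; exact hδm
  have hpow := pow_succ_le_of_integral_sin_pow_le k (by linarith) heπ hδk h
  -- `eᵐ = 2ᵐ (e/2)ᵐ ≤ 2ᵐ m (π/2)^{m-1} δ = 2 m π^{m-1} δ`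
  have h2 : e = 2 * (e / 2) := by ring
  calc e ^ (k + 1) = 2 ^ (k + 1) * (e / 2) ^ (k + 1) := by rw [h2, mul_pow]; ring
    _ ≤ 2 ^ (k + 1) * ((k + 1) * (Real.pi / 2) ^ k * δ) :=
        mul_le_mul_of_nonneg_left hpow (by positivity)
    _ = 2 * (k + 1 : ℕ) * Real.pi ^ k * δ := by
        push_cast
        rw [div_pow, pow_succ]
        field_simp

end Excess

/-! ### §3 The estimate in the binders of `Colding1996_volume_ghClose` -/

section FactVocabulary

open Bundle
open Literature.Geometry.Lorentzian (riemannianMeasure)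

/-- **Almost antipodal points have small excess, in the binders of `Colding1996_volume_ghClose`**
(Colding 1996, §1): on a closed connected Riemannian `n`-manifold `(M, h)`, `n ≥ 2`, with
`Ric ≥ (n - 1) h`, if `0 ≤ δ < π/(2n)` and `d(p, q) ≥ π - δ` for the Riemannian distance of `h`,
then `(d(p, x) + d(x, q) - d(p, q))ⁿ ≤ 2 n π^{n-1} δ` for every `x`
(`excess_pow_le_of_edist_ge_pi_sub` for `g = ofRiemannian h`, whose distance is `riemannianEDist`
by `rfl`). Together with the almost antipodes provided by the volume hypothesis
(`exists_riemannianEDist_ge_pi_sub_of_volume_ge`) this is the input "`cos d_q = -cos d_p + ψ`"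
of the approximation step of Colding's proof. [cite: Colding1996Shape, §1]
[cite: Colding1997Aspects, §1–§2] -/
theorem excess_pow_le_of_riemannianEDist_ge_pi_sub (n : ℕ) (hn : 2 ≤ n)
    (M : Type) [TopologicalSpace M] [T2Space M] [SecondCountableTopology M]
    [ChartedSpace (EuclideanSpace ℝ (Fin n)) M] [IsManifold (𝓡 n) ∞ M] [CompactSpace M]
    [ConnectedSpace M] [MeasurableSpace M] [BorelSpace M]
    (h : Bundle.ContMDiffRiemannianMetric (𝓡 n) ∞ (EuclideanSpace ℝ (Fin n))
      (TangentSpace (𝓡 n) : M → Type _))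
    [(PseudoRiemannianMetric.ofRiemannian h).HasLeviCivita]
    (hRic : ∀ (x : M) (v : TangentSpace (𝓡 n) x),
      ((n : ℝ) - 1) * h.inner x v v ≤ (PseudoRiemannianMetric.ofRiemannian h).ricci x v v)
    {p q : M} {δ : ℝ} (hδ : 0 ≤ δ) (hδn : δ < Real.pi / (2 * n))
    (hpq : ENNReal.ofReal (Real.pi - δ) ≤
      (letI : Bundle.RiemannianBundle (fun x : M ↦ TangentSpace (𝓡 n) x) :=
        ⟨h.toContinuousRiemannianMetric.toRiemannianMetric⟩
      Manifold.riemannianEDist (𝓡 n) p q))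
    (x : M) :
    (letI : Bundle.RiemannianBundle (fun x : M ↦ TangentSpace (𝓡 n) x) :=
        ⟨h.toContinuousRiemannianMetric.toRiemannianMetric⟩
    ((Manifold.riemannianEDist (𝓡 n) p x).toReal + (Manifold.riemannianEDist (𝓡 n) x q).toReal -
        (Manifold.riemannianEDist (𝓡 n) p q).toReal) ^ n) ≤
      2 * n * Real.pi ^ (n - 1) * δ := by
  haveI : LocallyCompactSpace M := Manifold.locallyCompact_of_finiteDimensional (𝓡 n)
  haveI : T3Space M := inferInstance
  set g := PseudoRiemannianMetric.ofRiemannian h with hg_def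
  have hg : g.IsRiemannian := PseudoRiemannianMetric.isRiemannian_ofRiemannian h
  exact excess_pow_le_of_edist_ge_pi_sub g hg hn (fun x v ↦ hRic x v) hδ hδn hpq x

end FactVocabulary

end Literature.Geometry.Riemannian

end
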